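import Summits.NavierStokesRegularity.NavierStokesRegularity.Theorems.ExtremiserTransienceNearExtremalTransiencePerFlowOfFilamentSelectionAllTime
import Summits.NavierStokesRegularity.NavierStokesRegularity.Theorems.ExtremiserTransienceScrewSymmetricLiouville
import Summits.NavierStokesRegularity.NavierStokesRegularity.Theorems.SymmetryModuliCountSymmetricLiouvilleRotationCovariance
import Literature.Analysis.FluidPDE.BarkerPrange2020VorticityAlignmentTypeIHolds
import Literature.Analysis.FluidPDE.TypeIAncientMildTimeAnalytic
import Literature.Analysis.FluidPDE.TypeIAncientMildRescale
import Literature.Analysis.FluidPDE.OseenMildUniqueness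
import Literature.Analysis.FluidPDE.TypeIAncientMild
import HarnessLib

/-!
# LINE g11-β «symmetry harvest» (congruent cells) — crux `NearExtremalTransiencePerFlow` (stmt-NavierStokesRegularity-26567), route `ExtremiserTransience`

Ideator seat `ns-idea-5`, generation g11 (technique card «extremal-example mining»).  FILES-ONLY crux workfile (D-0145; no route is
opened, nothing is registered by this file).  HONEST FRAMING: no summit is proved by a line; this skeleton proves
`stub_tightOfBoundedBudget → stub_crystallineOrTight → NearExtremalTransiencePerFlow` using only LANDED dynamics (flow compactness T2′,
the extremal-slice exclusion E∞+R7, slice-germ rigidity R7 re-proved here, and rung R8 `screwSymmetricLiouville` BY NAME).  It is a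
PURELY STATIC reduction of the crux: both stubs are statements about near-extremal families of smooth divergence-free fields on `ℝ³`;
no hypothesis about Navier–Stokes flows remains.

## Why this line (the lever in five words: «near-optimal crowds must crystallise»)

What the extremal examples look like (instrument rows FIXED-B/C′, CROWD-OPEN j312749, DILUTE-GAP j327037/j327350 of g7–g10): every
near-maximiser of the depletion efficiency `J/(M√Z√P)` found so far is a CROWD OF CONGRUENT CELLS — copies of one quadratic bump at
(nearly) equal heights, (nearly) equal spacings, (nearly) equal relative attitudes, arranged along a chain (linear growth forbids sheets).
Mined as mathematics: near-optimality should force ORDER.  The heart S♯ `CrystallineOrTight` says that a near-extremal family with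
UNBOUNDED enstrophy budget (the only regime left after LINE g11-α's lemma T, which is this line's second stub, shared verbatim) has —
at centres of the prover's choosing — a translate-limit that is either an exact extremiser or coincides, on a neighbourhood of one
non-trivial cell, with its own image under a rigid motion `x ↦ L⁻¹x + b` with non-zero drift `b` along the motion's axis (`L b = b`):
a screw-periodic or periodic necklace germ.  Heuristic = 1D CRYSTALLISATION (Gardner–Radin / Ventevogel; Blanc–Lewin arXiv:1504.01153):
if the optimal cell–cell contact is non-degenerate, a deficit `εₙ → 0` spread over `Nₙ → ∞` contacts leaves windows of consecutive
contacts with deviations `→ 0`, and the diagonal translate-limit through such windows repeats EXACTLY.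
The dynamic side is entirely in the tree: ETERNAL SYMMETRY (`isometryInvariant_allTime_of_local`, re-proved below from slice analyticity
`IsTypeIAncientMild.analyticOnNhd_slice_univ`, forward uniqueness `oseenMild_bounded_unique`, time analyticity `analyticAt_time`, and the
class covariances `comp_add_right`, `stub_rotationCovariance`) upgrades the local germ symmetry of the slice `W s = W₀` to a global
symmetry of the Type-I ancient mild solution `W` at all negative times, and rung R8 `screwSymmetricLiouville` (KNSS 2009 Thm 6.2
mechanism, landed by ns-net-p2) kills every such `W` — so the non-trivial cell contradicts `W ≡ 0`.  The tight branch dies by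
`not_isExtremalSlice_of_typeIAncientMild` as in every line of record; the bounded-budget regime is routed through T.

bears_on: LADDER-NS rung of record for 26567 (K-a) and rung R8 `ScrewSymmetricLiouville` (its first consumer on the canonical path:
R8 was landed for the NECKLACE BRIEF of LINE g9 but no skeleton used it).  Residual enemy (named): GLASSY near-extremal crowds —
aperiodic infinite necklaces whose every window carries contact deviations bounded below, i.e. a DEGENERATE (flat) optimal contact.

## Why novel vs the listed routes/lines
Nearest: g10-β `TightOrChain` / g10-γ `TightOrCrowding` (non-tight branch = a COUNT of cells in a ball, killed by the energy LEDGER);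
g9 H′ `IsTubeSlice` (a tube test, gerrymanderable).  Delta: the non-tight branch here is an exact SYMMETRY GERM (a rigid-motion
coincidence on an open patch), killed by analyticity + a symmetric Liouville theorem — no ledger, no counting, no tube test, no gauge;
and the kill is UNCONDITIONAL in the tree today.  ns-idea-10's `local_maximiser` line uses a second-variation lever on single cells;
this line uses the first-order structure of crowds (congruence), not variations.

## Cheapest falsifier · instrument row
Falsifier of S♯: a near-extremal sequence of FREE chains (positions, attitudes, heights all free) whose optimal configurations stay
DISORDERED — spacing/attitude variance along the chain not → 0 as the deficit → 0.  INSTRUMENT row «ORDER-PARAMETER» (proposed to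
director-ns; engine = g8 CROWD-OPEN j312749 with per-cell pose read-out): for N = 8…64 free cells record (efficiency deficit, variance of
consecutive spacings, variance of consecutive relative rotations); S♯ predicts variance ≲ C·deficit (non-degenerate contact).  A flat
direction (variance bounded below at vanishing deficit) retires the line.

## Instrument result (rev 2) — row «ORDER-PARAMETER» RUN (PREREG `pub/ideators/ns-idea-5/inst/PREREG_order.md`, MAIN j328946):
pre-registered word DISORDER-PERSISTS — the free periodic near-optimal crowds (R 0.122, N = 96) are AMPLITUDE-CONGRUENT (cell heights equal to 1 %)
but POSITIONALLY LIQUID (enstrophy-density autocorrelation ≤ 0.06 beyond 2λ; nearest-neighbour distance CV 0.33, growing along the ascent).  S♯'s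
cheapest support therefore FAILS at the accessible deficit; the heart is priced «disfavoured unless disorder costs efficiency in the limit».
Firming row «SUPERCELL» (j329119, best (15/M)-periodic crystal vs the free glass): pre-registered word **ORDER-PAYS** (j329119, log `inst/j329119_supercell_stdout.log`): free glass R_1 = 0.1228/0.1225 vs best (15/M)-periodic crystals R_2 = 0.1231, R_3 = 0.1302, R_4 = 0.1282, R_5 = 0.1285, R_6 = 0.13847 (unit cell a = 2.5 ≈ 8.5λ with 19 equal-height peaks, cv_h = 0.001, λ/λ_min = 2.1) — imposing a period RAISES the best efficiency found by up to +0.016 (13 %), and 0.1385 exceeds every earlier record of the programme (g8 κ_per 0.1254; certified κ⋆ ≥ 0.1247, j320466): the glassy optima of the free ascent are METASTABLE, disorder COSTS efficiency, and the best known near-extremal crowds are CRYSTALS — exactly the structure S♯ posits and R8 kills. Net price of S♯ after both rows: «supported in mechanism at the accessible resolution (order pays; record configurations periodic), glassy families exist only ≥ 0.016 below the best value found»; record candidate under seed/resolution check (SUPERCELL-2: j329361 N=96, j329362 N=128; fields with R ≥ 0.13 saved for the KStar certification machinery, item 24370). No summit is proved by a number.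

## C0 / probes (planner's record; see the card `symmetry_harvest.md`)
R 4 · A 3 (first lemma of S♯ = non-degeneracy of the two-cell contact, typed below as `ContactGap`) · L 4 · B 4 (all catalogued NS
barriers are about flows; the dynamic side is landed) · K 4 (ORDER-PARAMETER row is cheap).  BC2/BC7 in the card.
-/

noncomputable section

open scoped Topology InnerProductSpace RealInnerProductSpace ENNReal ContDiff
open MeasureTheory Filter Set Metric Function
open Literature.Analysis Literature.Analysis.FluidPDE
open Summit.NavierStokesRegularity.NavierStokesRegularity.Theses.ExtremiserTransience
open Summit.NavierStokesRegularity.NavierStokesRegularity.Theorems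
open Summit.NavierStokesRegularity.NavierStokesRegularity.Theorems.DepletionLadder.KStar.HalfSpace
open Summit.NavierStokesRegularity.NavierStokesRegularity.Theorems.NearExtremalTransiencePerFlow.ZoneTransversality
open Summit.NavierStokesRegularity.NavierStokesRegularity.Theorems.NearExtremalTransiencePerFlow.MemberSelection
open Summit.NavierStokesRegularity.NavierStokesRegularity.Theorems.NearExtremalTransiencePerFlow

namespace Summit.NavierStokesRegularity.NavierStokesRegularity.Cruxes.NearExtremalTransiencePerFlow.SymmetryHarvest

set_option linter.dupNamespace false

/-! ## §1 The stub statements -/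

/-- A CRYSTALLINE GERM of a field `W₀ : ℝ³ → ℝ³`: on some non-empty open patch `U`, `W₀` coincides with its own conjugate
`x ↦ L (W₀ (L⁻¹ x + b))` under a rigid motion with linear part `L` and NON-ZERO drift `b` along the motion's axis (`L b = b`; `L = 1` is a
pure period `b`, otherwise a screw), and `W₀` does not vanish identically ON THE PATCH `U` (rev 3, critics' N1: non-vanishing on `U`, not merely
somewhere — a field vanishing on `U ∪ (L⁻¹U + b)` must not qualify).  (Vector fields transform by push-forward, hence the outer `L`.) -/
def HasCrystallineGerm (W₀ : E3 → E3) : Prop :=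
  ∃ (L : E3 ≃ₗᵢ[ℝ] E3) (b : E3) (U : Set E3), L b = b ∧ b ≠ 0 ∧ IsOpen U ∧ U.Nonempty ∧
    (∀ z ∈ U, L (W₀ (L.symm z + b)) = W₀ z) ∧ ∃ z₀ ∈ U, W₀ z₀ ≠ 0

/-- A VACUUM GERM of `W₀` (rev 4, free third exit): `W₀` vanishes identically on some non-empty open patch but not everywhere — the translate-limit of a
DILUTE crowd whose inter-cell gaps become exact vacuum.  Killed by slice analyticity alone (no Liouville theorem needed). -/
def HasVacuumGerm (W₀ : E3 → E3) : Prop :=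
  ∃ U : Set E3, IsOpen U ∧ U.Nonempty ∧ (∀ z ∈ U, W₀ z = 0) ∧ ∃ z₀ : E3, W₀ z₀ ≠ 0

/-- **STUB S♯ — «crystalline or tight»** (static HEART, NEW).  A near-extremal height-`1` family (`NearExtremalFamily`) with eventual
linear local-energy growth and UNBOUNDED enstrophy budgets `Z(v n) → ∞` admits centres `y`, a subsequence `φ` and a pointwise
translate-limit `W₀` which is an exact extremiser of the sharp depletion inequality OR carries a crystalline germ OR (rev 4, free exit for
dilute families) a vacuum germ.
Why it might fail: GLASSY near-extremisers — if the optimal cell–cell contact has a flat direction (degenerate relative pose), infinite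
near-optimal necklaces can be aperiodic in every window (twist sequence `k²√2`), and no translate-limit repeats exactly. -/
def CrystallineOrTight : Prop :=
  ∀ (v : ℕ → E3 → E3) (Λ : ℕ → ℝ) (Θ : ℝ) (ε : ℕ → ℝ) (A : ℝ),
    NearExtremalFamily v Λ Θ ε →
    (∀ᶠ n in atTop, ∀ (x : E3) (R : ℝ), 0 < R → ∫ z in Metric.ball x R, ‖v n z‖ ^ 2 ≤ A * R) →
    Tendsto (fun n => ∫ x, ‖curl (v n) x‖ ^ 2) atTop atTop →
    ∃ (y : ℕ → E3) (φ : ℕ → ℕ) (W₀ : E3 → E3), StrictMono φ ∧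
      (∀ z : E3, Tendsto (fun n => v (φ n) (y (φ n) + z)) atTop (𝓝 (W₀ z))) ∧
      (IsExtremalSlice W₀ ∨ HasCrystallineGerm W₀ ∨ HasVacuumGerm W₀)

/-- **STUB T — «bounded budget forces an extremal limit»** (static, L; VERBATIM the statement of LINE g11-α `leray_pincer`
`TightOfBoundedBudget` — one item if registered).  See that file for the proof sketch (Biot–Savart cluster count, sea identity,
`extendedSharp`, one Cauchy–Schwarz). -/
def TightOfBoundedBudget : Prop :=
  ∀ (v : ℕ → E3 → E3) (Λ : ℕ → ℝ) (Θ : ℝ) (ε : ℕ → ℝ) (A Zb : ℝ),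
    NearExtremalFamily v Λ Θ ε →
    (∀ᶠ n in atTop, ∀ (x : E3) (R : ℝ), 0 < R → ∫ z in Metric.ball x R, ‖v n z‖ ^ 2 ≤ A * R) →
    (∃ᶠ n in atTop, ∫ x, ‖curl (v n) x‖ ^ 2 ≤ Zb) →
    ∃ (y : ℕ → E3) (φ : ℕ → ℕ) (W₀ : E3 → E3), StrictMono φ ∧
      (∀ z : E3, Tendsto (fun n => v (φ n) (y (φ n) + z)) atTop (𝓝 (W₀ z))) ∧ IsExtremalSlice W₀

/-- The first lemma of S♯, typed (Attack axis of C0; NOT registered, not used by the skeleton): a CONTACT GAP — two admissible fields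
with disjointly supported vorticities placed at distance `≥ D` apart gain nothing: the efficiency of the sum is at most the larger of the
two efficiencies plus `C/D`.  (Far-field strain of a compactly supported vortex decays like `Z/D`; the in-file «sea identity» of LINE α.)
Its quantitative refinement — a strictly positive second-order cost of deviating from the optimal relative pose — is the non-degeneracy
S♯ needs. -/
def ContactGap : Prop :=
  ∃ C : ℝ, 0 < C ∧ ∀ (v w : E3 → E3) (D : ℝ), 0 < D →
    ContDiff ℝ (⊤ : ℕ∞) v → ContDiff ℝ (⊤ : ℕ∞) w → VectorCalculus.IsDivFree v → VectorCalculus.IsDivFree w →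
    (∀ x, ‖v x‖ ≤ 1) → (∀ x, ‖w x‖ ≤ 1) → (∀ x, ‖v x + w x‖ ≤ 1) →
    (∀ x y, curl v x ≠ 0 → curl w y ≠ 0 → D ≤ dist x y) →
    (∫⁻ x, ‖iteratedFDeriv ℝ 1 v x‖ₑ ^ 2 < ⊤) → (∫⁻ x, ‖iteratedFDeriv ℝ 2 v x‖ₑ ^ 2 < ⊤) →
    (∫⁻ x, ‖iteratedFDeriv ℝ 1 w x‖ₑ ^ 2 < ⊤) → (∫⁻ x, ‖iteratedFDeriv ℝ 2 w x‖ₑ ^ 2 < ⊤) →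
    |∫ x, ⟪curl (v + w) x, fderiv ℝ (v + w) x (curl (v + w) x)⟫_ℝ| ≤
      (kStar + C / D) * Real.sqrt (∫ x, ‖curl (v + w) x‖ ^ 2) *
        Real.sqrt (∫ x, frobeniusNormSq (fderiv ℝ (curl (v + w)) x))

/-! ## §2 Dynamics proved in this file: slice-germ rigidity (R7) and ETERNAL SYMMETRY (verbatim re-proofs of the kernel-checked
theorems of the g9 workfile `Lines/filament_selection.lean`, so that this file imports only `Theorems/` and `Literature/`) -/

/-- **R7 — slice-germ rigidity**: two Type-I ancient mild fields whose slices at one time `s < 0` agree on a non-empty open set agree at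
all negative times (space analyticity ⇒ equal slices; forward: `oseenMild_bounded_unique`; backward: time analyticity).
[cite: LemarieRieusset2016, Thm. 9.12 (PDF p. 260)] -/
theorem sliceGermRigidity (K₁ K₂ : ℝ) (W₁ W₂ : ℝ → E3 → E3) (U : Set E3) (s : ℝ)
    (hW₁ : IsTypeIAncientMild K₁ W₁) (hW₂ : IsTypeIAncientMild K₂ W₂) (hU : IsOpen U) (hne : U.Nonempty) (hs : s < 0)
    (hgerm : ∀ x ∈ U, W₁ s x = W₂ s x) : ∀ σ : ℝ, σ < 0 → ∀ x, W₁ σ x = W₂ σ x := by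
  -- step 1: the two slices at time `s` agree everywhere (spatial analyticity)
  have hsp : AnalyticOnNhd ℝ (fun y : E3 => W₁ s y - W₂ s y) Set.univ :=
    (hW₁.analyticOnNhd_slice_univ hs).sub (hW₂.analyticOnNhd_slice_univ hs)
  obtain ⟨x₀, hx₀⟩ := hne
  have hev : (fun y : E3 => W₁ s y - W₂ s y) =ᶠ[𝓝 x₀] 0 := by
    filter_upwards [hU.mem_nhds hx₀] with y hy
    simp only [Pi.zero_apply, sub_eq_zero]
    exact hgerm y hy
  have hz := hsp.eqOn_zero_of_preconnected_of_eventuallyEq_zero isPreconnected_univ (Set.mem_univ x₀) hev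
  have hslice : W₁ s = W₂ s := funext fun y => by
    have h0 := hz (Set.mem_univ y)
    simpa [sub_eq_zero] using h0
  -- step 2: forward, by uniqueness of bounded Oseen-mild solutions on the slab `(s, t/2) × ℝ³`
  have hfwd : ∀ t : ℝ, s < t → t < 0 → W₁ t = W₂ t := by
    intro t hst ht
    have hT0 : t / 2 < 0 := by linarith
    have htT : t < t / 2 := by linarith
    obtain ⟨M₁, hM₁⟩ := hW₁.isBoundedOn (δ := -(t / 2)) (by linarith)
    obtain ⟨M₂, hM₂⟩ := hW₂.isBoundedOn (δ := -(t / 2)) (by linarith)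
    have hIio : ∀ τ ∈ Set.Ioo s (t / 2), τ ∈ Set.Iio (-(-(t / 2))) := fun τ hτ => by
      simp only [neg_neg, Set.mem_Iio]; exact hτ.2
    have hM0 : 0 ≤ max M₁ M₂ :=
      ((norm_nonneg _).trans (hM₁ t (by simp only [neg_neg, Set.mem_Iio]; exact htT) 0)).trans (le_max_left _ _)
    have h1M : ∀ τ ∈ Set.Ioo s (t / 2), ∀ y, ‖W₁ τ y‖ ≤ max M₁ M₂ := fun τ hτ y =>
      (hM₁ τ (hIio τ hτ) y).trans (le_max_left _ _)
    have h2M : ∀ τ ∈ Set.Ioo s (t / 2), ∀ y, ‖W₂ τ y‖ ≤ max M₁ M₂ := fun τ hτ y =>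
      (hM₂ τ (hIio τ hτ) y).trans (le_max_right _ _)
    have h1m := hW₁.aestronglyMeasurable_uncurry (s := s) hT0.le
    have h2m := hW₂.aestronglyMeasurable_uncurry (s := s) hT0.le
    have h1' : ∀ τ ∈ Set.Ioo s (t / 2), W₁ τ =ᵐ[volume] fun y =>
        Literature.Analysis.UnboundedOperators.heatExtension (W₁ s) (τ - s) y - oseenDuhamel 1 s W₁ W₁ τ y :=
      fun τ hτ => Filter.Eventually.of_forall fun y => hW₁.mild_eq_heatExtension hτ.1 (hτ.2.trans hT0) y
    have h2' : ∀ τ ∈ Set.Ioo s (t / 2), W₂ τ =ᵐ[volume] fun y =>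
        Literature.Analysis.UnboundedOperators.heatExtension (W₁ s) (τ - s) y - oseenDuhamel 1 s W₂ W₂ τ y :=
      fun τ hτ => Filter.Eventually.of_forall fun y => by
        rw [hslice]; exact hW₂.mild_eq_heatExtension hτ.1 (hτ.2.trans hT0) y
    have hae := oseenMild_bounded_unique one_pos hM0 h1m h2m h1M h2M h1' h2' t ⟨hst, htT⟩
    exact (Continuous.ae_eq_iff_eq volume (hW₁.continuous_slice ht) (hW₂.continuous_slice ht)).1 hae
  -- step 3: backward, by time analyticity
  intro σ hσ x
  have han : AnalyticOnNhd ℝ (fun τ : ℝ => W₁ τ x - W₂ τ x) (Set.Iio 0) := fun τ hτ0 =>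
    (hW₁.analyticAt_time hτ0 x).sub (hW₂.analyticAt_time hτ0 x)
  have hm : s / 2 ∈ Set.Iio (0 : ℝ) := by
    simp only [Set.mem_Iio]; linarith
  have hev2 : (fun τ : ℝ => W₁ τ x - W₂ τ x) =ᶠ[𝓝 (s / 2)] 0 := by
    have hI : Set.Ioo s 0 ∈ 𝓝 (s / 2) := Ioo_mem_nhds (by linarith) (by linarith)
    filter_upwards [hI] with τ hτ
    simp only [Pi.zero_apply, sub_eq_zero]
    exact congr_fun (hfwd τ hτ.1 hτ.2) x
  have h0 := han.eqOn_zero_of_preconnected_of_eventuallyEq_zero isPreconnected_Iio hm hev2 hσ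
  simpa [sub_eq_zero] using h0

/-- **ETERNAL SYMMETRY**: if ONE slice of a Type-I ancient mild field agrees with its conjugate `x ↦ L (W s (L⁻¹x + b))` under an affine
isometry on ONE non-empty open patch, EVERY slice is globally symmetric (R7 applied to the conjugated field, which is again Type-I
ancient mild: `comp_add_right` + `stub_rotationCovariance`). [cite: KochNadirashviliSereginSverak2009, §4 (arXiv:0709.3599 p. 8)] -/
theorem isometryInvariant_allTime_of_local (K : ℝ) (W : ℝ → E3 → E3) (U : Set E3) (s : ℝ) (L : E3 ≃ₗᵢ[ℝ] E3) (b : E3)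
    (hW : IsTypeIAncientMild K W) (hU : IsOpen U) (hne : U.Nonempty) (hs : s < 0)
    (hloc : ∀ x ∈ U, L (W s (L.symm x + b)) = W s x) :
    ∀ σ : ℝ, σ < 0 → ∀ x, L (W σ (L.symm x + b)) = W σ x :=
  sliceGermRigidity K K (fun t x => L (W t (L.symm x + b))) W U s
    (SymmetryModuliCountSymmetricLiouville.stub_rotationCovariance K L _ (hW.comp_add_right b)) hW hU hne hs hloc

/-- A crystalline germ on one slice of a Type-I ancient mild field is impossible: eternal symmetry makes `W` screw/translation
symmetric at all negative times and rung R8 `screwSymmetricLiouville` gives `W ≡ 0`, contradicting the non-trivial cell. -/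
theorem not_hasCrystallineGerm_of_typeIAncientMild {K : ℝ} {W : ℝ → E3 → E3} (hW : IsTypeIAncientMild K W) {s : ℝ}
    (hs : s < 0) : ¬ HasCrystallineGerm (W s) := by
  rintro ⟨L, b, U, hLb, hb, hU, hne, hloc, z₀, -, hz₀⟩
  have hall := isometryInvariant_allTime_of_local K W U s L b hW hU hne hs hloc
  have hLsb : L.symm b = b := by
    conv_lhs => rw [← hLb]
    exact L.symm_apply_apply b
  have hsym : ∀ τ : ℝ, τ < 0 → ∀ x, W τ (L.symm x + b) = L.symm (W τ x) := by
    intro τ hτ x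
    rw [← hall τ hτ x, LinearIsometryEquiv.symm_apply_apply]
  have hzero := ScrewSymmetricLiouville.screwSymmetricLiouville K W L.symm b hW hLsb hb hsym s hs z₀
  exact hz₀ hzero

/-- A vacuum germ on one slice of a Type-I ancient mild field is impossible: the slice is real-analytic on `ℝ³`
(`IsTypeIAncientMild.analyticOnNhd_slice_univ`), so vanishing on a non-empty open set forces `W s ≡ 0`. -/
theorem not_hasVacuumGerm_of_typeIAncientMild {K : ℝ} {W : ℝ → E3 → E3} (hW : IsTypeIAncientMild K W) {s : ℝ}
    (hs : s < 0) : ¬ HasVacuumGerm (W s) := by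
  rintro ⟨U, hU, ⟨x₀, hx₀⟩, hvac, z₀, hz₀⟩
  have han : AnalyticOnNhd ℝ (W s) Set.univ := hW.analyticOnNhd_slice_univ hs
  have hev : W s =ᶠ[𝓝 x₀] 0 := by
    filter_upwards [hU.mem_nhds hx₀] with y hy
    exact hvac y hy
  have hz := han.eqOn_zero_of_preconnected_of_eventuallyEq_zero isPreconnected_univ (Set.mem_univ x₀) hev
  exact hz₀ (hz (Set.mem_univ z₀))

/-! ## §3 The two registered-style stubs and their registration names -/

/-- STUB S♯ (static heart). -/
theorem stub_crystallineOrTight : CrystallineOrTight := by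
  sorry

/-- STUB T (static, L; = LINE α's `TightOfBoundedBudget`). -/
theorem stub_tightOfBoundedBudget : TightOfBoundedBudget := by
  sorry

namespace Registered

/-- = `CrystallineOrTight`. -/
abbrev stub_crystallineOrTight : Prop := CrystallineOrTight
/-- = `TightOfBoundedBudget`. -/
abbrev stub_tightOfBoundedBudget : Prop := TightOfBoundedBudget

end Registered

/-! ## §4 THE SKELETON: S♯ + T ⇒ the crux BY NAME (no `sorry` outside the two stubs; every dynamic input is a theorem) -/

/-- **LINE g11-β SKELETON.**  Violator frame by contradiction → F1 growth budget (`flowFilamentBudget`) → T0 data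
(`efficientTimesNoDust_holds`) → T2′ zoom family + flow compactness (`zoomPackageFlow`) → member growth (`ballEnergy_zoom_le`) →
budget dichotomy: bounded along a subsequence (→ T: extremal limit) or `→ ∞` (→ S♯: extremal limit or crystalline germ) → flow
compactness at the chosen centres: `W₀ = W s`, `W` Type-I ancient mild, `s < 0` → extremal: `not_isExtremalSlice_of_typeIAncientMild`;
crystalline: `not_hasCrystallineGerm_of_typeIAncientMild` (eternal symmetry + R8); vacuum: `not_hasVacuumGerm_of_typeIAncientMild` (analyticity). -/
theorem NearExtremalTransiencePerFlow_of
    (hS : Registered.stub_crystallineOrTight) (hT : Registered.stub_tightOfBoundedBudget) :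
    NearExtremalTransiencePerFlow := by
  have hT0 : EfficientTimesNoDust := efficientTimesNoDust_holds
  intro C ν T hC hν hT' u p hsol hLH hdec hrate hsing
  by_contra hno
  have hV : IsViolator C ν T u p := ⟨hC, hν, hT', hsol, hLH, hdec, hrate, hsing, hno⟩
  obtain ⟨A, hA⟩ := FilamentGap.flowFilamentBudget C ν T hC hν hT' u p hsol hLH hdec hrate
  obtain ⟨Θ, t, Mb, ε, hdata⟩ := hT0 C ν T u p hV
  obtain ⟨σ, Λ, Θ', ε', hσ, hfam, hcompF⟩ := FilamentSelection.zoomPackageFlow C ν T u p hV Θ t Mb ε hdata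
  set V : ℕ → E3 → E3 := fun n z => (Mb (σ n))⁻¹ • u (t (σ n)) ((ν / Mb (σ n)) • z) with hVdef
  have htT : Tendsto (fun n => t (σ n)) atTop (𝓝[<] T) := by
    have h1 : Tendsto (fun n => t (σ n)) atTop (𝓝 T) := hdata.2.1.comp hσ.tendsto_atTop
    exact tendsto_nhdsWithin_iff.2 ⟨h1, Eventually.of_forall fun n => (hdata.1 (σ n)).2⟩
  have hgrV : ∀ᶠ n in atTop, ∀ (x : E3) (R : ℝ), 0 < R → ∫ z in Metric.ball x R, ‖V n z‖ ^ 2 ≤ A * R := by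
    filter_upwards [htT.eventually hA] with n hn x R hR
    have h := FilamentSelection.ballEnergy_zoom_le hν (hdata.2.2.2.1 (σ n)) hn 0 x hR
    simpa only [zero_add] using h
  -- centres, subsequence and limit: extremal or crystalline (S♯ if the budgets blow up, T otherwise)
  have hsel : ∃ (y : ℕ → E3) (φ : ℕ → ℕ) (W₀ : E3 → E3), StrictMono φ ∧
      (∀ z : E3, Tendsto (fun n => V (φ n) (y (φ n) + z)) atTop (𝓝 (W₀ z))) ∧
      (IsExtremalSlice W₀ ∨ HasCrystallineGerm W₀ ∨ HasVacuumGerm W₀) := by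
    by_cases hZ : Tendsto (fun n => ∫ x, ‖curl (V n) x‖ ^ 2) atTop atTop
    · exact hS V Λ Θ' ε' A hfam hgrV hZ
    · -- not `→ ∞`: some level `Zb` is undershot frequently
      have hfr : ∃ Zb : ℝ, ∃ᶠ n in atTop, ∫ x, ‖curl (V n) x‖ ^ 2 ≤ Zb := by
        by_contra hcon
        push Not at hcon
        apply hZ
        rw [tendsto_atTop_atTop]
        intro Zb
        obtain ⟨N, hN⟩ := (hcon Zb).exists_forall_of_atTop
        exact ⟨N, fun n hn => (hN n hn).le⟩
      obtain ⟨Zb, hZb⟩ := hfr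
      obtain ⟨y, φ, W₀, hφ, hconv, hext⟩ := hT V Λ Θ' ε' A Zb hfam hgrV hZb
      exact ⟨y, φ, W₀, hφ, hconv, Or.inl hext⟩
  obtain ⟨y, φ, W₀, hφ, hconv, hdich⟩ := hsel
  obtain ⟨ψ, K', s, W, hψ, hW, hs, hpin, hconvF⟩ := hcompF y φ hφ
  have hconv' : ∀ z : E3, Tendsto (fun n => V (φ (ψ n)) (y (φ (ψ n)) + z)) atTop (𝓝 (W s z)) := by
    intro z
    have h1 := hconvF s hs z
    simp only [sub_self, mul_zero, add_zero] at h1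
    exact h1
  have hWs : W s = W₀ :=
    funext fun z => tendsto_nhds_unique (hconv' z) ((hconv z).comp hψ.tendsto_atTop)
  subst hWs
  rcases hdich with hext | hcry | hvac
  · exact not_isExtremalSlice_of_typeIAncientMild hW hs hext
  · exact not_hasCrystallineGerm_of_typeIAncientMild hW hs hcry
  · exact not_hasVacuumGerm_of_typeIAncientMild hW hs hvac

/-- Sanity: the skeleton applied to the two `sorry`-stubs elaborates and concludes the route decl. -/
example : NearExtremalTransiencePerFlow :=
  NearExtremalTransiencePerFlow_of stub_crystallineOrTight stub_tightOfBoundedBudget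

end Summit.NavierStokesRegularity.NavierStokesRegularity.Cruxes.NearExtremalTransiencePerFlow.SymmetryHarvest

end
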